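import Literature.MathematicalPhysics.QuantumManyBody.PenroseOnsager1956
import Literature.MathematicalPhysics.QuantumManyBody.PeriodicBoseGasThm31
import HarnessLib

/-!
# Route BECBathMassLiouville — `FrozenBathNoBEC` (stmt-AtomisticToContinuum-13803), helper file 5:
# two volume bounds for i.i.d. uniform scatterers

The probabilistic half of the frozen-bath statement, as plain volume estimates on
`cell^M = [0,L)^{3M}` (product Lebesgue measure on `Config M`):

* `volume_setOf_forall_mem`: `|{Y | ∀ j, Yⱼ ∈ A}| = |A|^M` (product set).
* `mul_volume_count_le` (first moment / Markov): for a family of measurable sets `S_q ⊆ [0,L)³` of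
  common volume `σ`, `t · |{Y ∈ cell^M | t ≤ #{q | ∀ j, Yⱼ ∉ S_q}}| ≤ #I · (L³ - σ)^M`.
* `volume_noVoid_mul_le` (second moment / Cauchy–Schwarz): for a partition `(T_q)_{q ∈ I}` of
  `[0,L)³` into `K` measurable pieces of common finite volume `τ`, the set `D` of configurations
  leaving NO piece empty satisfies `|D| · ((K-1) · ((K-1)τ)^M) ≤ ((Kτ)^M)²`, i.e.
  `|D|/|cell^M| ≤ 1/((K-1)p)` with `p = ((K-1)/K)^M` the probability that a given piece is empty:
  with `Z = ∑_q 1[piece q empty]`, `(∫Z)² ≤ |Z ≠ 0| ∫Z²`, `∫Z = K A`, `∫Z² = KA + K(K-1)B`,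
  `A = ((K-1)τ)^M`, `B = ((K-2)τ)^M`, `B (Kτ)^M ≤ A²`.
* `exp_neg_le_one_sub_inv_pow`: `e^{-2M/K} ≤ (1 - 1/K)^M` for `K ≥ 2`.

All elementary; no literature input beyond the objects (LSSY2005 §1.2 for `Config`, `cell`).
-/

noncomputable section

namespace Summit.AtomisticToContinuum.BoseEinsteinCondensation.Theorems.FrozenBath

open MeasureTheory Metric Set Filter
open scoped ENNReal NNReal
open Literature.MathematicalPhysics.QuantumManyBody.BoseGas

variable {L : ℝ} {M : ℕ}

/-! ## Product sets of configurations -/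

/-- `{Y | ∀ j, Yⱼ ∈ A}` is the product set `∏ⱼ A`. [folklore] -/
theorem setOf_forall_mem_eq_pi (A : Set Space) :
    {Y : Config M | ∀ j, Y j ∈ A} = Set.pi univ fun _ => A := by
  ext Y; simp

/-- `|{Y | ∀ j, Yⱼ ∈ A}| = |A|^M`. [folklore] -/
theorem volume_setOf_forall_mem (A : Set Space) :
    volume {Y : Config M | ∀ j, Y j ∈ A} = volume A ^ M := by
  rw [setOf_forall_mem_eq_pi, volume_pi, Measure.pi_pi]
  simp [Finset.prod_const]

/-- `{Y | ∀ j, Yⱼ ∈ A}` is measurable for measurable `A`. [folklore] -/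
theorem measurableSet_setOf_forall_mem {A : Set Space} (hA : MeasurableSet A) :
    MeasurableSet {Y : Config M | ∀ j, Y j ∈ A} := by
  rw [setOf_forall_mem_eq_pi]
  exact MeasurableSet.univ_pi fun _ => hA

/-- Configurations in the cell avoiding `S`: `{Y | ∀ j, Yⱼ ∉ S} ∩ cell^M = {Y | ∀ j, Yⱼ ∈ cell ∖ S}`.
[folklore] -/
theorem setOf_forall_notMem_inter_cellN (S : Set Space) :
    {Y : Config M | ∀ j, Y j ∉ S} ∩ cellN M L = {Y : Config M | ∀ j, Y j ∈ cell L \ S} := by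
  ext Y
  simp only [mem_inter_iff, mem_setOf_eq, cellN, Set.mem_sdiff]
  constructor
  · rintro ⟨h1, h2⟩ j
    exact ⟨h2 j, h1 j⟩
  · intro h
    exact ⟨fun j => (h j).2, fun j => (h j).1⟩

/-- `{Y | ∀ j, Yⱼ ∉ S}` is measurable for measurable `S`. [folklore] -/
theorem measurableSet_setOf_forall_notMem {S : Set Space} (hS : MeasurableSet S) :
    MeasurableSet {Y : Config M | ∀ j, Y j ∉ S} := by
  have h : {Y : Config M | ∀ j, Y j ∉ S} = {Y : Config M | ∀ j, Y j ∈ Sᶜ} := rfl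
  rw [h]
  exact measurableSet_setOf_forall_mem hS.compl

/-- **Volume of the configurations avoiding a set**: for measurable `S ⊆ [0,L)³`,
`|{Y ∈ cell^M | ∀ j, Yⱼ ∉ S}| = (L³ - |S|)^M`. [folklore] -/
theorem volume_setOf_forall_notMem_inter_cellN {S : Set Space} (hS : MeasurableSet S)
    (hSsub : S ⊆ cell L) :
    volume ({Y : Config M | ∀ j, Y j ∉ S} ∩ cellN M L) =
      (ENNReal.ofReal L ^ 3 - volume S) ^ M := by
  have hfin : volume S ≠ ⊤ := by
    refine (lt_of_le_of_lt (measure_mono hSsub) ?_).ne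
    rw [volume_cell]
    exact ENNReal.pow_lt_top ENNReal.ofReal_lt_top
  rw [setOf_forall_notMem_inter_cellN, volume_setOf_forall_mem,
    measure_sdiff hSsub hS.nullMeasurableSet hfin, volume_cell]

/-! ## First moment: the number of empty cells -/

/-- The number of indices `q` whose set `S_q` contains no point of `Y`, as a sum of indicators.
[folklore] -/
theorem sum_indicator_eq_card {I : Type*} [Fintype I] (S : I → Set Space) (Y : Config M)
    [DecidablePred fun q => ∀ j, Y j ∉ S q] :
    ∑ q, ({Y : Config M | ∀ j, Y j ∉ S q}).indicator (1 : Config M → ℝ≥0∞) Y =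
      ((Finset.univ.filter fun q => ∀ j, Y j ∉ S q).card : ℝ≥0∞) := by
  classical
  simp only [Set.indicator_apply, mem_setOf_eq, Pi.one_apply, Finset.sum_boole]

/-- **Markov bound for the number of empty cells.** For measurable `S_q ⊆ [0,L)³` (`q ∈ I`) of
common volume `σ` and every `t`,
`t · |{Y ∈ cell^M | t ≤ #{q | ∀ j, Yⱼ ∉ S_q}}| ≤ #I · (L³ - σ)^M`
(the right-hand side is `∫_{cell^M} #{q | S_q empty} dY`). [folklore] -/
theorem mul_volume_count_le {I : Type*} [Fintype I] (S : I → Set Space)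
    (hSm : ∀ q, MeasurableSet (S q)) (hSsub : ∀ q, S q ⊆ cell L) {σ : ℝ≥0∞}
    (hσ : ∀ q, volume (S q) = σ) (t : ℝ≥0∞) [∀ Y : Config M, DecidablePred fun q => ∀ j, Y j ∉ S q] :
    t * volume {Y : Config M | Y ∈ cellN M L ∧
        t ≤ ((Finset.univ.filter fun q => ∀ j, Y j ∉ S q).card : ℝ≥0∞)} ≤
      (Fintype.card I : ℝ≥0∞) * (ENNReal.ofReal L ^ 3 - σ) ^ M := by
  classical
  set N : Config M → ℝ≥0∞ := fun Y =>
    ∑ q, ({Y : Config M | ∀ j, Y j ∉ S q}).indicator (1 : Config M → ℝ≥0∞) Y with hNdef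
  have hN : ∀ Y, N Y = ((Finset.univ.filter fun q => ∀ j, Y j ∉ S q).card : ℝ≥0∞) := fun Y => by
    rw [hNdef]
    convert sum_indicator_eq_card S Y
  have hNm : Measurable N :=
    Finset.measurable_sum _ fun q _ => measurable_one.indicator (measurableSet_setOf_forall_notMem (hSm q))
  have hmk := mul_meas_ge_le_lintegral₀ (μ := volume.restrict (cellN M L)) hNm.aemeasurable t
  have hset : {Y : Config M | Y ∈ cellN M L ∧
      t ≤ ((Finset.univ.filter fun q => ∀ j, Y j ∉ S q).card : ℝ≥0∞)} =
      {Y | t ≤ N Y} ∩ cellN M L := by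
    ext Y
    simp only [mem_setOf_eq, mem_inter_iff, hN Y]
    exact and_comm
  rw [hset, ← Measure.restrict_apply (measurableSet_le measurable_const hNm)]
  refine hmk.trans (le_of_eq ?_)
  rw [hNdef, lintegral_finsetSum _ fun q _ =>
    measurable_one.indicator (measurableSet_setOf_forall_notMem (hSm q))]
  simp only [lintegral_indicator_one (measurableSet_setOf_forall_notMem (hSm _)),
    Measure.restrict_apply (measurableSet_setOf_forall_notMem (hSm _)),
    volume_setOf_forall_notMem_inter_cellN (hSm _) (hSsub _), hσ, Finset.sum_const,
    Finset.card_univ, nsmul_eq_mul]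

/-! ## Second moment: some cell of a partition is empty -/

/-- `(K-2)K ≤ (K-1)²` in `ℕ`. [folklore] -/
theorem sub_two_mul_le_sq (K : ℕ) : (K - 2) * K ≤ (K - 1) ^ 2 := by
  rcases le_or_gt 2 K with h | h
  · obtain ⟨j, rfl⟩ := Nat.exists_eq_add_of_le' h
    simp only [Nat.add_sub_cancel, Nat.add_succ_sub_one]
    nlinarith
  · interval_cases K <;> simp

section Partition

variable {I : Type*} [Fintype I] (T : I → Set Space)

/-- For a partition of `[0,L)³` into `K` measurable pieces of volume `τ`, `L³ = K τ`. [folklore] -/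
theorem volume_cell_eq_card_mul (hTm : ∀ q, MeasurableSet (T q))
    (hdisj : Pairwise (Function.onFun Disjoint T)) (hcover : ⋃ q, T q = cell L) {τ : ℝ≥0∞}
    (hτ : ∀ q, volume (T q) = τ) : ENNReal.ofReal L ^ 3 = (Fintype.card I : ℝ≥0∞) * τ := by
  rw [← volume_cell, ← hcover, measure_iUnion hdisj hTm, tsum_fintype]
  simp [hτ, Finset.card_univ]

/-- The complement of one piece has volume `(K-1)τ`. [folklore] -/
theorem volume_cell_diff (hTm : ∀ q, MeasurableSet (T q))
    (hdisj : Pairwise (Function.onFun Disjoint T)) (hcover : ⋃ q, T q = cell L) {τ : ℝ≥0∞}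
    (hτ : ∀ q, volume (T q) = τ) (hτt : τ ≠ ⊤) (q : I) :
    volume (cell L \ T q) = ((Fintype.card I - 1 : ℕ) : ℝ≥0∞) * τ := by
  have hsub : T q ⊆ cell L := hcover ▸ subset_iUnion T q
  rw [measure_sdiff hsub (hTm q).nullMeasurableSet (by rw [hτ]; exact hτt), volume_cell,
    volume_cell_eq_card_mul T hTm hdisj hcover hτ, hτ, ENNReal.natCast_sub, Nat.cast_one,
    ENNReal.sub_mul fun _ _ => hτt, one_mul]

/-- The complement of two distinct pieces has volume `(K-2)τ`. [folklore] -/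
theorem volume_cell_diff_union (hTm : ∀ q, MeasurableSet (T q))
    (hdisj : Pairwise (Function.onFun Disjoint T)) (hcover : ⋃ q, T q = cell L) {τ : ℝ≥0∞}
    (hτ : ∀ q, volume (T q) = τ) (hτt : τ ≠ ⊤) {q q' : I} (hqq' : q ≠ q') :
    volume (cell L \ (T q ∪ T q')) = ((Fintype.card I - 2 : ℕ) : ℝ≥0∞) * τ := by
  have hsub : T q ∪ T q' ⊆ cell L :=
    union_subset (hcover ▸ subset_iUnion T q) (hcover ▸ subset_iUnion T q')
  have hvol : volume (T q ∪ T q') = 2 * τ := by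
    rw [measure_union (hdisj hqq') (hTm q'), hτ, hτ, two_mul]
  rw [measure_sdiff hsub ((hTm q).union (hTm q')).nullMeasurableSet
      (by rw [hvol]; exact ENNReal.mul_ne_top ENNReal.ofNat_ne_top hτt),
    volume_cell, volume_cell_eq_card_mul T hTm hdisj hcover hτ, hvol, ENNReal.natCast_sub,
    Nat.cast_ofNat, ENNReal.sub_mul fun _ _ => hτt]

/-- **Second-moment bound: some piece of the partition is empty, with high probability.** For a
partition `(T_q)_{q∈I}` of `[0,L)³` into `K` measurable pieces of common finite volume `τ` and the
set `D = {Y ∈ cell^M | ∀ q ∃ j, Yⱼ ∈ T_q}` of configurations leaving no piece empty,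
`|D| · ((K-1) ((K-1)τ)^M) ≤ ((Kτ)^M)²`. Proof: with `E_q = {Y ∈ cell^M | T_q empty}`,
`Z = ∑_q 1_{E_q}`, `U = ⋃ E_q = cell^M ∖ D`: `∫Z = KA`, `∫Z² = KA + K(K-1)B` (`A = ((K-1)τ)^M`,
`B = ((K-2)τ)^M`), Cauchy–Schwarz `(∫Z)² ≤ |U| ∫Z²`, `B (Kτ)^M ≤ A²`, and
`|U| + |D| = (Kτ)^M`. [folklore] -/
theorem volume_noVoid_mul_le (hTm : ∀ q, MeasurableSet (T q))
    (hdisj : Pairwise (Function.onFun Disjoint T)) (hcover : ⋃ q, T q = cell L) {τ : ℝ≥0∞}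
    (hτ : ∀ q, volume (T q) = τ) (hτt : τ ≠ ⊤) :
    volume {Y : Config M | Y ∈ cellN M L ∧ ∀ q, ∃ j, Y j ∈ T q} *
        (((Fintype.card I - 1 : ℕ) : ℝ≥0∞) * ((((Fintype.card I - 1 : ℕ) : ℝ≥0∞) * τ) ^ M)) ≤
      ((((Fintype.card I : ℕ) : ℝ≥0∞) * τ) ^ M) ^ 2 := by
  classical
  set K : ℕ := Fintype.card I with hK
  set A : ℝ≥0∞ := (((K - 1 : ℕ) : ℝ≥0∞) * τ) ^ M with hA
  set B : ℝ≥0∞ := (((K - 2 : ℕ) : ℝ≥0∞) * τ) ^ M with hB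
  set V : ℝ≥0∞ := (((K : ℕ) : ℝ≥0∞) * τ) ^ M with hV
  set D : Set (Config M) := {Y : Config M | Y ∈ cellN M L ∧ ∀ q, ∃ j, Y j ∈ T q} with hD
  -- trivial cases
  rcases eq_or_ne ((((K - 1 : ℕ) : ℝ≥0∞)) * A) 0 with h0 | h0
  · rw [h0, mul_zero]; exact zero_le
  have hK1 : 1 ≤ K := by
    by_contra h
    push Not at h
    have : K - 1 = 0 := by omega
    rw [this] at h0
    simp at h0
  have hA0 : A ≠ 0 := fun h => h0 (by rw [h, mul_zero])
  have hAt : A ≠ ⊤ := ENNReal.pow_ne_top (ENNReal.mul_ne_top (ENNReal.natCast_ne_top _) hτt)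
  have hVt : V ≠ ⊤ := ENNReal.pow_ne_top (ENNReal.mul_ne_top (ENNReal.natCast_ne_top _) hτt)
  have hKt : ((K : ℕ) : ℝ≥0∞) ≠ ⊤ := ENNReal.natCast_ne_top _
  have hK0 : ((K : ℕ) : ℝ≥0∞) ≠ 0 := by exact_mod_cast (show K ≠ 0 by omega)
  -- the events `E q` and their volumes
  set E : I → Set (Config M) := fun q => {Y : Config M | ∀ j, Y j ∉ T q} ∩ cellN M L with hE
  have hEm : ∀ q, MeasurableSet (E q) := fun q =>
    (measurableSet_setOf_forall_notMem (hTm q)).inter (measurableSet_cellN M L)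
  have hcellvol : volume (cellN M L) = V := by
    rw [volume_cellN, volume_cell_eq_card_mul T hTm hdisj hcover hτ]
  have hEvol : ∀ q, volume (E q) = A := fun q => by
    rw [hE]
    dsimp only
    rw [setOf_forall_notMem_inter_cellN, volume_setOf_forall_mem,
      volume_cell_diff T hTm hdisj hcover hτ hτt q]
  have hEEvol : ∀ q q', q ≠ q' → volume (E q ∩ E q') = B := fun q q' hqq' => by
    have hset : E q ∩ E q' = {Y : Config M | ∀ j, Y j ∈ cell L \ (T q ∪ T q')} := by
      ext Y
      simp only [hE, mem_inter_iff, mem_setOf_eq, cellN, Set.mem_sdiff, Set.mem_union, not_or]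
      constructor
      · rintro ⟨⟨h1, h2⟩, h3, -⟩ j
        exact ⟨h2 j, h1 j, h3 j⟩
      · intro h
        exact ⟨⟨fun j => (h j).2.1, fun j => (h j).1⟩, fun j => (h j).2.2, fun j => (h j).1⟩
    rw [hset, volume_setOf_forall_mem, volume_cell_diff_union T hTm hdisj hcover hτ hτt hqq']
  -- `Z` and its first two moments
  set Z : Config M → ℝ≥0∞ := fun Y => ∑ q, (E q).indicator (1 : Config M → ℝ≥0∞) Y with hZ
  have hZm : Measurable Z := Finset.measurable_sum _ fun q _ => measurable_one.indicator (hEm q)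
  have hZ1 : ∫⁻ Y, Z Y = K * A := by
    rw [hZ, lintegral_finsetSum _ fun q _ => measurable_one.indicator (hEm q)]
    simp only [lintegral_indicator_one (hEm _), hEvol, Finset.sum_const, Finset.card_univ,
      nsmul_eq_mul, hK]
  have hZ2 : ∫⁻ Y, Z Y ^ 2 = K * A + K * ((K - 1 : ℕ) * B) := by
    have hsq : ∀ Y, Z Y ^ 2 = ∑ q, ∑ q', (E q ∩ E q').indicator (1 : Config M → ℝ≥0∞) Y := by
      intro Y
      rw [sq, hZ, Finset.sum_mul_sum]
      refine Finset.sum_congr rfl fun q _ => Finset.sum_congr rfl fun q' _ => ?_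
      by_cases h1 : Y ∈ E q <;> by_cases h2 : Y ∈ E q' <;>
        simp [h1, h2, Set.indicator_of_mem, Set.indicator_of_notMem]
    simp_rw [hsq]
    rw [lintegral_finsetSum _ fun q _ => Finset.measurable_sum _ fun q' _ =>
      measurable_one.indicator ((hEm q).inter (hEm q'))]
    have hinner : ∀ q, ∫⁻ Y, ∑ q', (E q ∩ E q').indicator (1 : Config M → ℝ≥0∞) Y =
        A + (K - 1 : ℕ) * B := by
      intro q
      rw [lintegral_finsetSum _ fun q' _ => measurable_one.indicator ((hEm q).inter (hEm q'))]
      simp only [lintegral_indicator_one ((hEm _).inter (hEm _))]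
      rw [← Finset.add_sum_erase _ _ (Finset.mem_univ q), inter_self, hEvol]
      congr 1
      rw [Finset.sum_congr rfl fun q' hq' => hEEvol q q' (Finset.ne_of_mem_erase hq').symm,
        Finset.sum_const, Finset.card_erase_of_mem (Finset.mem_univ q), Finset.card_univ,
        nsmul_eq_mul, hK]
    simp only [hinner, Finset.sum_const, Finset.card_univ, nsmul_eq_mul, hK, mul_add]
  -- `U = ⋃ E q` and the partition `cell^M = U ∪ D`
  set U : Set (Config M) := ⋃ q, E q with hU
  have hUm : MeasurableSet U := MeasurableSet.iUnion hEm
  have hUD : volume U + volume D = V := by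
    have hdisjUD : Disjoint U D := by
      rw [hU, Set.disjoint_iUnion_left]
      intro q
      rw [Set.disjoint_left]
      rintro Y ⟨hY1, -⟩ ⟨-, hY2⟩
      obtain ⟨j, hj⟩ := hY2 q
      exact hY1 j hj
    have hunion : U ∪ D = cellN M L := by
      ext Y
      simp only [hU, hD, hE, mem_union, mem_iUnion, mem_inter_iff, mem_setOf_eq]
      constructor
      · rintro (⟨q, -, hY⟩ | ⟨hY, -⟩) <;> exact hY
      · intro hY
        by_cases h : ∀ q, ∃ j, Y j ∈ T q
        · exact Or.inr ⟨hY, h⟩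
        · push Not at h
          obtain ⟨q, hq⟩ := h
          exact Or.inl ⟨q, hq, hY⟩
    have hDm : MeasurableSet D := by
      have : D = cellN M L \ U := by
        rw [← hunion, Set.union_sdiff_cancel_left (Set.disjoint_iff.1 hdisjUD)]
      rw [this]
      exact (measurableSet_cellN M L).diff hUm
    rw [← measure_union hdisjUD hDm, hunion, hcellvol]
  -- Cauchy–Schwarz: `(∫ Z)² ≤ |U| ∫ Z²`
  have hCS : (K * A) ^ 2 ≤ volume U * (K * A + K * ((K - 1 : ℕ) * B)) := by
    have hsupp : Function.support Z ⊆ U := by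
      intro Y hY
      rw [Function.mem_support, hZ] at hY
      obtain ⟨q, -, hq⟩ := Finset.exists_ne_zero_of_sum_ne_zero hY
      rw [hU, mem_iUnion]
      exact ⟨q, Set.mem_of_indicator_ne_zero hq⟩
    rw [← hZ2, ← hZ1, ← setLIntegral_eq_of_support_subset hsupp]
    calc (∫⁻ Y in U, Z Y) ^ 2 ≤ (volume.restrict U) univ * ∫⁻ Y in U, Z Y ^ 2 :=
          Literature.MathematicalPhysics.QuantumManyBody.BoseGas.PenroseOnsager.lintegral_sq_le_mul_lintegral_sq
            _ hZm.aemeasurable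
      _ ≤ volume U * ∫⁻ Y, Z Y ^ 2 := by
          rw [Measure.restrict_apply_univ]
          exact mul_le_mul_right (setLIntegral_le_lintegral _ _) _
  -- `B V ≤ A²`
  have hBV : B * V ≤ A * A := by
    rw [hB, hV, hA, ← mul_pow, ← mul_pow]
    refine pow_le_pow_left' ?_ M
    calc ((K - 2 : ℕ) : ℝ≥0∞) * τ * ((K : ℕ) * τ) = ((K - 2 : ℕ) * K : ℕ) * (τ * τ) := by
          push_cast; ring
      _ ≤ ((K - 1 : ℕ) ^ 2 : ℕ) * (τ * τ) := by
          gcongr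
          exact_mod_cast sub_two_mul_le_sq K
      _ = (K - 1 : ℕ) * τ * ((K - 1 : ℕ) * τ) := by push_cast; ring
  -- `K A V ≤ |U| (V + (K-1) A)`
  have hmain : K * A * V ≤ volume U * (V + (K - 1 : ℕ) * A) := by
    have h1 : (K * A) ^ 2 * V ≤ volume U * (K * A * V + K * ((K - 1 : ℕ) * (A * A))) := by
      calc (K * A) ^ 2 * V ≤ volume U * (K * A + K * ((K - 1 : ℕ) * B)) * V :=
            mul_le_mul_left hCS _
        _ = volume U * (K * A * V + K * ((K - 1 : ℕ) * (B * V))) := by ring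
        _ ≤ volume U * (K * A * V + K * ((K - 1 : ℕ) * (A * A))) := by gcongr
    have h2 : (K * A) * (K * A * V) ≤ (K * A) * (volume U * (V + (K - 1 : ℕ) * A)) := by
      calc (K * A) * (K * A * V) = (K * A) ^ 2 * V := by ring
        _ ≤ volume U * (K * A * V + K * ((K - 1 : ℕ) * (A * A))) := h1
        _ = (K * A) * (volume U * (V + (K - 1 : ℕ) * A)) := by ring
    exact (ENNReal.mul_le_mul_iff_right (mul_ne_zero hK0 hA0) (ENNReal.mul_ne_top hKt hAt)).1 h2
  -- conclude
  have hfinal : volume D * (V + (K - 1 : ℕ) * A) ≤ V ^ 2 := by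
    have hKAV : K * A * V ≠ ⊤ := ENNReal.mul_ne_top (ENNReal.mul_ne_top hKt hAt) hVt
    have h : volume D * (V + (K - 1 : ℕ) * A) + K * A * V ≤ V ^ 2 + K * A * V := by
      calc volume D * (V + (K - 1 : ℕ) * A) + K * A * V
          ≤ volume D * (V + (K - 1 : ℕ) * A) + volume U * (V + (K - 1 : ℕ) * A) :=
            add_le_add_right hmain _
        _ = (volume U + volume D) * (V + (K - 1 : ℕ) * A) := by ring
        _ = V ^ 2 + (K - 1 : ℕ) * A * V := by rw [hUD]; ring
        _ ≤ V ^ 2 + K * A * V := by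
            gcongr
            exact_mod_cast Nat.sub_le K 1
    exact ENNReal.le_of_add_le_add_right hKAV h
  calc volume D * ((K - 1 : ℕ) * A) ≤ volume D * (V + (K - 1 : ℕ) * A) := by
        gcongr
        exact le_add_self
    _ ≤ V ^ 2 := hfinal

end Partition

/-! ## The empty-cell probability is not too small -/

/-- `e^{-2x} ≤ 1 - x` for `0 ≤ x ≤ 1/2` (from `1 + 2x ≤ e^{2x}` and `(1+2x)(1-x) ≥ 1`).
[folklore] -/
theorem exp_neg_two_mul_le_one_sub {x : ℝ} (hx0 : 0 ≤ x) (hx : x ≤ 1 / 2) :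
    Real.exp (-(2 * x)) ≤ 1 - x := by
  have h1 : 1 + 2 * x ≤ Real.exp (2 * x) := by
    have := Real.add_one_le_exp (2 * x); linarith
  have h2 : 1 ≤ (1 + 2 * x) * (1 - x) := by nlinarith
  have hpos : 0 < Real.exp (2 * x) := Real.exp_pos _
  rw [Real.exp_neg, inv_le_iff_one_le_mul₀ hpos]
  calc 1 ≤ (1 + 2 * x) * (1 - x) := h2
    _ ≤ Real.exp (2 * x) * (1 - x) := by
        apply mul_le_mul_of_nonneg_right h1
        linarith
    _ = (1 - x) * Real.exp (2 * x) := mul_comm _ _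

/-- **`e^{-2M/K} ≤ (1 - 1/K)^M` for `K ≥ 2`**: the probability `((K-1)/K)^M` that a given one of `K`
equal cells receives none of `M` uniform points is at least `e^{-2M/K}`. [folklore] -/
theorem exp_neg_le_one_sub_inv_pow {K : ℝ} (hK : 2 ≤ K) (M : ℕ) :
    Real.exp (-(2 * M / K)) ≤ (1 - 1 / K) ^ M := by
  have hKpos : 0 < K := by linarith
  have hx0 : 0 ≤ 1 / K := by positivity
  have hx : 1 / K ≤ 1 / 2 := one_div_le_one_div_of_le (by norm_num) hK
  have h := exp_neg_two_mul_le_one_sub hx0 hx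
  have hnn : 0 ≤ Real.exp (-(2 * (1 / K))) := (Real.exp_pos _).le
  calc Real.exp (-(2 * M / K)) = Real.exp (-(2 * (1 / K))) ^ M := by
        rw [← Real.exp_nat_mul]
        congr 1
        ring
    _ ≤ (1 - 1 / K) ^ M := pow_le_pow_left₀ hnn h M

end Summit.AtomisticToContinuum.BoseEinsteinCondensation.Theorems.FrozenBath

end
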